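import Literature.MathematicalPhysics.QuantumLattice.QuantumRotorTruncatedInfrared
import Literature.MathematicalPhysics.QuantumLattice.XYOrderIntegralProofs
import HarnessLib

/-!
# Truncated quantum rotators: sum rule, truncation defects, and long-range order of the
# Galerkin ground states

Sibling file of `QuantumRotorTruncated*.lean` (item
`provefact-Literature.MathematicalPhysics.QuantumLa-0bccfc6de5`, the named fact
`QuantumRotor.KleinPerez1992_rotorGroundStateLRO`). No statement is touched. This is the rotator
version of the assembly `XYOrderProofs.kennedy_lieb_shastry_xy_ground_of_riemannSum_le`
(Kennedy–Lieb–Shastry 1988, eqs. (5)–(8)) for the tracial ground state `ω` of the Galerkin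
matrices `H_M` on the even tori, following [WojtkiewiczPuszStachura2016] §3.3 (the sum rule
`Σ_k g_k = |Λ|/2`, Lemma 3.4 `⟨ŝˣŝˣ*⟩ = ⟨ŝʸŝʸ*⟩`, and Thm. 3.3):

* the quarter turn `φ ↦ φ + π/2` at every site is a symmetry of `H_M` exchanging `cos` and `sin`,
  whence `ω(sin_x sin_y) = ω(cos_x cos_y)` (`groundStateFunctional_siteSin_mul_siteSin`, Lemma 3.4)
  and `ω(cos_x²) = ½ - ¼ ω(Π_x)` (the truncation defect of `cos² + sin² = 1`);
* the structure factor of the first component through the two modes and its **sum rule**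
  (`sum_structureFactor`): `Σ_q (ω(C_q²) + ω(D_q²)) = L^d Σ_x ω(cos_x²)`;
* the a priori bounds `E₀(H_M) ≤ 0` (momentum-zero product state) and
  `(h/2) Σ_x ω(N_x²) ≤ J d L^d`, whence `Σ_x ω(Π_x) ≤ 2dJL^d/(hM²)` (Chebyshev);
* the comparison `E_q^{-1/2} ≤ 2 F_d(q) + 2` with the KLS integrand, so that the punctured
  Riemann sums of `E^{-1/2}` are bounded by the tree's `klsRiemannSum`;
* **long-range order of the Galerkin ground states, quantitatively**
  (`truncated_groundState_lro`): on the even torus of side `L = 2k ≥ 4`, for `M ≥ 1`, `h, J > 0`,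
  `L^{-2d} Σ_{x,y} ω(cos_x cos_y + sin_x sin_y) ≥ 1 - dJ/(hM²) - 2 √(Γ_M/(8J)) (2 R_L + 2)`,
  `Γ_M = h + J(2d/M + (dM/2 + d/2)·2dJ/(hM²))`, `R_L` the KLS Riemann sum — the finite-`M`
  form of `2|Λ|⁻²Σ_{x,y}⟨cos(φ_x-φ_y)⟩ ≥ 1 - 2√(h/8J)·(lattice sum)` of the continuum argument.

## References

* [WojtkiewiczPuszStachura2016] J. Wojtkiewicz, W. Pusz, P. Stachura, Rep. Math. Phys. 77 (2016)
  183–209 (arXiv:1507.03079), §3.3, Lemma 3.4, Thm. 3.3.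
* [KLS1988PRL] T. Kennedy, E. H. Lieb, B. S. Shastry, Phys. Rev. Lett. 61 (1988) 2582–2584,
  eqs. (5)–(8).
* [KLS1988JSP] T. Kennedy, E. H. Lieb, B. S. Shastry, J. Stat. Phys. 53 (1988) 1019–1030.
-/

noncomputable section

open Matrix Complex Finset Filter Topology
open scoped ComplexOrder
open Literature.Probability.LatticeModels

namespace Literature.MathematicalPhysics.QuantumLattice

namespace QuantumRotor

attribute [local instance 100] LieRing.ofAssociativeRing

variable {d : ℕ}

/-! ### The quarter turn: `ω(sin_x sin_y) = ω(cos_x cos_y)` -/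

section QuarterTurn

variable (M : ℕ) {Λ : Type*} [Fintype Λ] [DecidableEq Λ]

/-- The global quarter turn `W = ⨂_x R_x`. [folklore] -/
def quarterTurnOp : Op Λ (2 * M + 1) := productOp fun _ : Λ => truncQuarterTurn M

/-- `W Wᴴ = 1`. [folklore] -/
theorem quarterTurnOp_mul_conjTranspose : quarterTurnOp M * (quarterTurnOp M)ᴴ = (1 : Op Λ (2 * M + 1)) :=
  productOp_mul_conjTranspose fun _ => truncQuarterTurn_mul_conjTranspose M

/-- `Wᴴ W = 1`. [folklore] -/
theorem quarterTurnOp_conjTranspose_mul : (quarterTurnOp M)ᴴ * quarterTurnOp M = (1 : Op Λ (2 * M + 1)) :=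
  productOp_conjTranspose_mul fun _ => truncQuarterTurn_conjTranspose_mul M

/-- `W cos_x Wᴴ = -sin_x`. [folklore] -/
theorem quarterTurnOp_conj_siteCos (x : Λ) :
    quarterTurnOp M * siteCos M x * (quarterTurnOp M)ᴴ = -siteSin M x := by
  rw [quarterTurnOp, siteCos, productOp_conj_onSite (fun _ => truncQuarterTurn_mul_conjTranspose M),
    truncQuarterTurn_conj_truncCos, onSite_neg', siteSin]

/-- `W sin_x Wᴴ = cos_x`. [folklore] -/
theorem quarterTurnOp_conj_siteSin (x : Λ) :
    quarterTurnOp M * siteSin M x * (quarterTurnOp M)ᴴ = siteCos M x := by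
  rw [quarterTurnOp, siteSin, productOp_conj_onSite (fun _ => truncQuarterTurn_mul_conjTranspose M),
    truncQuarterTurn_conj_truncSin, siteCos]

/-- `W N_x² Wᴴ = N_x²`. [folklore] -/
theorem quarterTurnOp_conj_siteMomentumSq (x : Λ) :
    quarterTurnOp M * siteMomentumSq M x * (quarterTurnOp M)ᴴ = siteMomentumSq M x := by
  rw [quarterTurnOp, siteMomentumSq, productOp_conj_onSite (fun _ => truncQuarterTurn_mul_conjTranspose M)]
  congr 1
  have h := truncQuarterTurn_conj_truncMomentum M
  have h1 := truncQuarterTurn_conjTranspose_mul M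
  calc truncQuarterTurn M * (truncMomentum M * truncMomentum M) * (truncQuarterTurn M)ᴴ
      = (truncQuarterTurn M * truncMomentum M * (truncQuarterTurn M)ᴴ) *
          (truncQuarterTurn M * truncMomentum M * (truncQuarterTurn M)ᴴ) := by
        simp only [Matrix.mul_assoc]
        rw [← Matrix.mul_assoc ((truncQuarterTurn M)ᴴ) (truncQuarterTurn M), h1, Matrix.one_mul]
    _ = truncMomentum M * truncMomentum M := by rw [h]

/-- Conjugation by `W` is multiplicative. [folklore] -/
theorem quarterTurnOp_conj_mul (A B : Op Λ (2 * M + 1)) :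
    quarterTurnOp M * (A * B) * (quarterTurnOp M)ᴴ =
      (quarterTurnOp M * A * (quarterTurnOp M)ᴴ) * (quarterTurnOp M * B * (quarterTurnOp M)ᴴ) := by
  simp only [Matrix.mul_assoc]
  rw [← Matrix.mul_assoc ((quarterTurnOp M)ᴴ) (quarterTurnOp M), quarterTurnOp_conjTranspose_mul,
    Matrix.one_mul]

/-- `W (cos_x cos_y + sin_x sin_y) Wᴴ = cos_x cos_y + sin_x sin_y`. [folklore] -/
theorem quarterTurnOp_conj_truncBond (x y : Λ) :
    quarterTurnOp M * truncBond M x y * (quarterTurnOp M)ᴴ = truncBond M x y := by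
  rw [truncBond, Matrix.mul_add, Matrix.add_mul, quarterTurnOp_conj_mul, quarterTurnOp_conj_mul,
    quarterTurnOp_conj_siteCos, quarterTurnOp_conj_siteCos, quarterTurnOp_conj_siteSin,
    quarterTurnOp_conj_siteSin, neg_mul_neg, add_comm (siteSin M x * siteSin M y)]

/-- **The quarter turn is a symmetry of the compressed Hamiltonian**: `W H_M Wᴴ = H_M`.
[cite: WojtkiewiczPuszStachura2016, Lemma 3.4] -/
theorem quarterTurnOp_conj_truncHamiltonian (nn : Λ → Λ → Prop) [DecidableRel nn] (h J : ℝ) :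
    quarterTurnOp M * truncHamiltonian M nn h J * (quarterTurnOp M)ᴴ = truncHamiltonian M nn h J := by
  rw [truncHamiltonian, Matrix.mul_sub, Matrix.sub_mul, Finset.mul_sum, Finset.sum_mul, Finset.mul_sum,
    Finset.sum_mul]
  congr 1
  · refine sum_congr rfl fun x _ => ?_
    rw [Matrix.mul_smul, Matrix.smul_mul, quarterTurnOp_conj_siteMomentumSq]
  · refine sum_congr rfl fun x _ => ?_
    rw [Finset.mul_sum, Finset.sum_mul]
    refine sum_congr rfl fun y _ => ?_
    rw [Matrix.mul_smul, Matrix.smul_mul, quarterTurnOp_conj_truncBond]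

/-- `W` commutes with `H_M`. [folklore] -/
theorem quarterTurnOp_mul_truncHamiltonian (nn : Λ → Λ → Prop) [DecidableRel nn] (h J : ℝ) :
    quarterTurnOp M * truncHamiltonian M nn h J = truncHamiltonian M nn h J * quarterTurnOp M := by
  have h1 := quarterTurnOp_conj_truncHamiltonian M nn h J
  calc quarterTurnOp M * truncHamiltonian M nn h J
      = quarterTurnOp M * truncHamiltonian M nn h J * ((quarterTurnOp M)ᴴ * quarterTurnOp M) := by
        rw [quarterTurnOp_conjTranspose_mul, Matrix.mul_one]
    _ = truncHamiltonian M nn h J * quarterTurnOp M := by rw [← Matrix.mul_assoc, h1]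

/-- **`ω(sin_x sin_y) = ω(cos_x cos_y)`** in the tracial ground state of `H_M` (the rotation
symmetry; [WojtkiewiczPuszStachura2016] Lemma 3.4, `⟨ŝˣ_k ŝˣ_k*⟩ = ⟨ŝʸ_k ŝʸ_k*⟩`).
[cite: WojtkiewiczPuszStachura2016, Lemma 3.4] -/
theorem groundStateFunctional_siteSin_mul_siteSin (nn : Λ → Λ → Prop) [DecidableRel nn] (h J : ℝ)
    (x y : Λ) :
    (truncHamiltonian M nn h J).groundStateFunctional (siteSin M x * siteSin M y) =
      (truncHamiltonian M nn h J).groundStateFunctional (siteCos M x * siteCos M y) := by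
  have hH := truncHamiltonian_isHermitian M nn h J
  have key := groundStateFunctional_conj_of_commute hH (quarterTurnOp_mul_truncHamiltonian M nn h J)
    (quarterTurnOp_conjTranspose_mul M) (siteCos M x * siteCos M y)
  rw [quarterTurnOp_conj_mul, quarterTurnOp_conj_siteCos, quarterTurnOp_conj_siteCos, neg_mul_neg] at key
  exact key

/-- `ω(cos_x²) = ½ - ¼ ω(Π_x)` (the sum rule's truncation defect per site).
[cite: WojtkiewiczPuszStachura2016, §3.3] -/
theorem re_groundStateFunctional_siteCos_sq (nn : Λ → Λ → Prop) [DecidableRel nn] (h J : ℝ)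
    [Nonempty Λ] (x : Λ) :
    ((truncHamiltonian M nn h J).groundStateFunctional (siteCos M x * siteCos M x)).re =
      1 / 2 - 1 / 4 * ((truncHamiltonian M nn h J).groundStateFunctional (siteEdgeProj M x)).re := by
  have hH := truncHamiltonian_isHermitian M nn h J
  have h1 := congrArg (fun O => ((truncHamiltonian M nn h J).groundStateFunctional O).re)
    (siteCos_sq_add_siteSin_sq M x)
  rw [map_add, groundStateFunctional_siteSin_mul_siteSin, map_sub, LinearMap.map_smul,
    groundStateFunctional_one hH, ← siteEdgeProj, Complex.add_re, Complex.sub_re, Complex.one_re,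
    smul_eq_mul, show (1 / 2 : ℂ) = ((1 / 2 : ℝ) : ℂ) by norm_num, Complex.re_ofReal_mul] at h1
  linarith

end QuarterTurn

/-! ### The structure factor through the modes, and the sum rule -/

section StructureFactor

variable (L : ℕ) [NeZero L] (M : ℕ)

/-- `ω(A_a A_b) = Σ_{x,y} a_x b_y ω(cos_x cos_y)` for real coefficient families. [folklore] -/
theorem groundStateFunctional_wave_mul_wave' (A : Op (TorusSite d L) (2 * M + 1))
    (a b : TorusSite d L → ℝ) :
    A.groundStateFunctional
        ((∑ x : TorusSite d L, (a x : ℂ) • siteCos M x) * ∑ y : TorusSite d L, (b y : ℂ) • siteCos M y) =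
      ∑ x : TorusSite d L, ∑ y : TorusSite d L, ((a x * b y : ℝ) : ℂ) *
        A.groundStateFunctional (siteCos M x * siteCos M y) := by
  rw [sum_mul_sum, map_sum]
  refine sum_congr rfl fun x _ => ?_
  rw [map_sum]
  refine sum_congr rfl fun y _ => ?_
  rw [smul_mul_assoc, mul_smul_comm, smul_smul, LinearMap.map_smul, smul_eq_mul, Complex.ofReal_mul]

/-- **The structure factor of the first component through the two modes**:
`Re ω(C_q²) + Re ω(D_q²) = Σ_{x,y} cos(q·(x-y)) Re ω(cos_x cos_y)`. [cite: KLS1988PRL, before eq. (2)]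
[cite: WojtkiewiczPuszStachura2016, §3.3] -/
theorem re_modes_sq_eq (A : Op (TorusSite d L) (2 * M + 1)) (q : TorusSite d L) :
    (A.groundStateFunctional (rotorCosMode L M q * rotorCosMode L M q)).re +
        (A.groundStateFunctional (rotorSinMode L M q * rotorSinMode L M q)).re =
      ∑ x : TorusSite d L, ∑ y : TorusSite d L,
        Real.cos (torusPhase L q (x - y)) * (A.groundStateFunctional (siteCos M x * siteCos M y)).re := by
  rw [rotorCosMode, rotorSinMode, groundStateFunctional_wave_mul_wave', groundStateFunctional_wave_mul_wave',
    Complex.re_sum, Complex.re_sum, ← sum_add_distrib]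
  refine sum_congr rfl fun x _ => ?_
  rw [Complex.re_sum, Complex.re_sum, ← sum_add_distrib]
  refine sum_congr rfl fun y _ => ?_
  rw [Complex.re_ofReal_mul, Complex.re_ofReal_mul, cos_torusPhase_sub]
  ring

/-- **The sum rule** (finite Parseval): `Σ_q (Re ω(C_q²) + Re ω(D_q²)) = L^d Σ_x Re ω(cos_x²)`
(`Σ_q cos(q·(x-y)) = L^d δ_{xy}`). [cite: KLS1988PRL, eq. (3)] [cite: WojtkiewiczPuszStachura2016, §3.3] -/
theorem sum_re_modes_sq (A : Op (TorusSite d L) (2 * M + 1)) :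
    ∑ q : TorusSite d L, ((A.groundStateFunctional (rotorCosMode L M q * rotorCosMode L M q)).re +
        (A.groundStateFunctional (rotorSinMode L M q * rotorSinMode L M q)).re) =
      (L : ℝ) ^ d * ∑ x : TorusSite d L, (A.groundStateFunctional (siteCos M x * siteCos M x)).re := by
  simp_rw [re_modes_sq_eq]
  rw [sum_comm]
  rw [mul_sum]
  refine sum_congr rfl fun x _ => ?_
  rw [sum_comm, ← Finset.sum_erase_add _ _ (mem_univ x)]
  rw [sum_eq_zero, zero_add]
  · rw [← sum_mul, sub_self, sum_cos_torusPhase, if_pos rfl]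
  · intro y hy
    have hyx : y ≠ x := (mem_erase.1 hy).1
    rw [← sum_mul, sum_cos_torusPhase, if_neg (sub_ne_zero.2 hyx.symm), zero_mul]

/-- At zero momentum: `Re ω(C_0²) + Re ω(D_0²) = Σ_{x,y} Re ω(cos_x cos_y)`. [folklore] -/
theorem re_modes_sq_zero (A : Op (TorusSite d L) (2 * M + 1)) :
    (A.groundStateFunctional (rotorCosMode L M 0 * rotorCosMode L M 0)).re +
        (A.groundStateFunctional (rotorSinMode L M 0 * rotorSinMode L M 0)).re =
      ∑ x : TorusSite d L, ∑ y : TorusSite d L, (A.groundStateFunctional (siteCos M x * siteCos M y)).re := by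
  rw [re_modes_sq_eq]
  simp

/-- **The order parameter is twice the cosine part**:
`Σ_{x,y} Re ω(cos_x cos_y + sin_x sin_y) = 2 Σ_{x,y} Re ω(cos_x cos_y)` (rotation symmetry).
[cite: WojtkiewiczPuszStachura2016, Lemma 3.4] -/
theorem sum_sum_re_groundStateFunctional_truncBond {Λ : Type*} [Fintype Λ] [DecidableEq Λ]
    (nn : Λ → Λ → Prop) [DecidableRel nn] (h J : ℝ) :
    ∑ x : Λ, ∑ y : Λ, ((truncHamiltonian M nn h J).groundStateFunctional (truncBond M x y)).re =
      2 * ∑ x : Λ, ∑ y : Λ, ((truncHamiltonian M nn h J).groundStateFunctional (siteCos M x * siteCos M y)).re := by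
  rw [mul_sum]
  refine sum_congr rfl fun x _ => ?_
  rw [mul_sum]
  refine sum_congr rfl fun y _ => ?_
  rw [truncBond, map_add, groundStateFunctional_siteSin_mul_siteSin, Complex.add_re]
  ring

end StructureFactor

/-! ### A priori bounds: `E₀(H_M) ≤ 0`, the kinetic energy, the edge weight -/

section EnergyBounds

variable (M : ℕ) {Λ : Type*} [Fintype Λ] [DecidableEq Λ]

/-- The momentum-zero configuration `n_x = 0` for all `x` (the constant wave function).
[folklore] -/
def zeroConfig : TensorIndex Λ (2 * M + 1) := fun _ => ⟨M, by omega⟩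

/-- `⟨0| N_x² |0⟩ = 0`. [folklore] -/
theorem siteMomentumSq_apply_zeroConfig (x : Λ) :
    siteMomentumSq M x (zeroConfig M) (zeroConfig M) = 0 := by
  rw [siteMomentumSq, onSite_apply, if_pos (fun y _ => rfl), truncMomentum_mul_self, diagonal_apply_eq]
  simp [zeroConfig]

/-- `⟨σ| U_x U_yᵀ |σ⟩ = 0` for `x ≠ y` (the hopping changes the momenta at `x` and `y`).
[folklore] -/
theorem siteRaise_mul_siteLower_apply_self {x y : Λ} (hxy : x ≠ y) (σ : TensorIndex Λ (2 * M + 1)) :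
    (siteRaise M x * siteLower M y) σ σ = 0 := by
  rw [Matrix.mul_apply]
  refine sum_eq_zero fun τ _ => ?_
  rw [siteRaise, siteLower, onSite_apply, onSite_apply]
  by_cases h1 : ∀ z, z ≠ x → σ z = τ z
  · rw [if_pos h1]
    by_cases h2 : ∀ z, z ≠ y → τ z = σ z
    · rw [if_pos h2, truncRaise_transpose_apply, h1 y hxy.symm, if_neg (by omega), mul_zero]
    · rw [if_neg h2, mul_zero]
  · rw [if_neg h1, zero_mul]

/-- `⟨σ| U_xᵀ U_y |σ⟩ = 0` for `x ≠ y`. [folklore] -/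
theorem siteLower_mul_siteRaise_apply_self {x y : Λ} (hxy : x ≠ y) (σ : TensorIndex Λ (2 * M + 1)) :
    (siteLower M x * siteRaise M y) σ σ = 0 := by
  rw [Matrix.mul_apply]
  refine sum_eq_zero fun τ _ => ?_
  rw [siteRaise, siteLower, onSite_apply, onSite_apply]
  by_cases h1 : ∀ z, z ≠ x → σ z = τ z
  · rw [if_pos h1]
    by_cases h2 : ∀ z, z ≠ y → τ z = σ z
    · rw [if_pos h2, truncRaise_apply, h1 y hxy.symm, if_neg (by omega), mul_zero]
    · rw [if_neg h2, mul_zero]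
  · rw [if_neg h1, zero_mul]

/-- `⟨σ| cos_x cos_y + sin_x sin_y |σ⟩ = 0` for `x ≠ y`. [folklore] -/
theorem truncBond_apply_self {x y : Λ} (hxy : x ≠ y) (σ : TensorIndex Λ (2 * M + 1)) :
    truncBond M x y σ σ = 0 := by
  rw [truncBond_eq_half, Matrix.smul_apply, Matrix.add_apply, siteRaise_mul_siteLower_apply_self M hxy,
    siteLower_mul_siteRaise_apply_self M hxy, add_zero, smul_zero]

/-- `⟨0| H_M |0⟩ = 0` for an irreflexive neighbour relation. [folklore] -/
theorem truncHamiltonian_apply_zeroConfig (nn : Λ → Λ → Prop) [DecidableRel nn] (hnn : ∀ x, ¬ nn x x)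
    (h J : ℝ) : truncHamiltonian M nn h J (zeroConfig M) (zeroConfig M) = 0 := by
  rw [truncHamiltonian, Matrix.sub_apply, Matrix.sum_apply, Matrix.sum_apply, sum_eq_zero, sum_eq_zero,
    sub_zero]
  · intro x _
    rw [Matrix.sum_apply]
    refine sum_eq_zero fun y hy => ?_
    have hxy : x ≠ y := fun h' => hnn x (h' ▸ (mem_filter.1 hy).2)
    rw [Matrix.smul_apply, truncBond_apply_self M hxy, smul_zero]
  · intro x _
    rw [Matrix.smul_apply, siteMomentumSq_apply_zeroConfig, smul_zero]

/-- **`E₀(H_M) ≤ 0`**: the constant wave function has zero energy (`⟨0|N²|0⟩ = 0` and the hopping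
has no diagonal). [folklore] -/
theorem truncHamiltonian_groundEnergy_nonpos (nn : Λ → Λ → Prop) [DecidableRel nn]
    (hnn : ∀ x, ¬ nn x x) (h J : ℝ) : (truncHamiltonian M nn h J).groundEnergy ≤ 0 := by
  have hH := truncHamiltonian_isHermitian M nn h J
  set ψ : TensorIndex Λ (2 * M + 1) → ℂ := Pi.single (zeroConfig M) 1 with hψ
  have hstar : star ψ = ψ := by rw [hψ, ← Pi.single_star, star_one]
  have hψ1 : star ψ ⬝ᵥ ψ = 1 := by rw [hstar, hψ, single_dotProduct, Pi.single_eq_same, mul_one]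
  have h1 := groundEnergy_le_rayleigh_holds hH ψ hψ1
  rwa [hstar, hψ, mulVec_single_one, single_dotProduct, one_mul, Matrix.col_apply,
    truncHamiltonian_apply_zeroConfig M nn hnn, Complex.zero_re] at h1

/-- `Re ω(cos_x cos_y + sin_x sin_y) ≤ 1` for `x ≠ y`. [folklore] -/
theorem re_groundStateFunctional_truncBond_le_one (A : Op Λ (2 * M + 1)) (hA : A.IsHermitian) [Nonempty Λ]
    {x y : Λ} (hxy : x ≠ y) : (A.groundStateFunctional (truncBond M x y)).re ≤ 1 := by
  have h1 := re_groundStateFunctional_mono A (posSemidef_one_sub_truncBond M hxy)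
  rwa [groundStateFunctional_one hA, Complex.one_re] at h1

/-- **The kinetic energy in the ground state**: `(h/2) Σ_x Re ω(N_x²) ≤ (J/2) Σ_x #{y ∼ x}` for
`h` arbitrary and `J ≥ 0` (from `ω(H_M) = E₀ ≤ 0` and `ω(bond) ≤ 1`). [folklore] -/
theorem sum_re_groundStateFunctional_siteMomentumSq_le (nn : Λ → Λ → Prop) [DecidableRel nn]
    (hnn : ∀ x, ¬ nn x x) [Nonempty Λ] (h : ℝ) {J : ℝ} (hJ : 0 ≤ J) :
    h / 2 * ∑ x : Λ, ((truncHamiltonian M nn h J).groundStateFunctional (siteMomentumSq M x)).re ≤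
      J / 2 * ∑ x : Λ, ((univ.filter (nn x)).card : ℝ) := by
  have hH := truncHamiltonian_isHermitian M nn h J
  have hE := groundStateFunctional_hamiltonian hH
  have hE0 := truncHamiltonian_groundEnergy_nonpos M nn hnn h J
  have hexp : ∀ A : Op Λ (2 * M + 1), (A.groundStateFunctional (truncHamiltonian M nn h J)).re =
      h / 2 * ∑ x : Λ, (A.groundStateFunctional (siteMomentumSq M x)).re -
        J / 2 * ∑ x : Λ, ∑ y ∈ univ.filter (nn x), (A.groundStateFunctional (truncBond M x y)).re := by
    intro A
    rw [truncHamiltonian, map_sub, map_sum, map_sum, Complex.sub_re, Complex.re_sum, Complex.re_sum,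
      mul_sum, mul_sum]
    congr 1
    · refine sum_congr rfl fun x _ => ?_
      rw [LinearMap.map_smul, smul_eq_mul, Complex.re_ofReal_mul]
    · refine sum_congr rfl fun x _ => ?_
      rw [map_sum, Complex.re_sum, mul_sum]
      refine sum_congr rfl fun y _ => ?_
      rw [LinearMap.map_smul, smul_eq_mul, Complex.re_ofReal_mul]
  have hbond : ∑ x : Λ, ∑ y ∈ univ.filter (nn x),
      ((truncHamiltonian M nn h J).groundStateFunctional (truncBond M x y)).re ≤
        ∑ x : Λ, ((univ.filter (nn x)).card : ℝ) := by
    refine sum_le_sum fun x _ => ?_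
    calc ∑ y ∈ univ.filter (nn x), ((truncHamiltonian M nn h J).groundStateFunctional (truncBond M x y)).re
        ≤ ∑ y ∈ univ.filter (nn x), (1 : ℝ) := sum_le_sum fun y hy =>
          re_groundStateFunctional_truncBond_le_one M _ hH (fun h' => hnn x (h' ▸ (mem_filter.1 hy).2))
      _ = ((univ.filter (nn x)).card : ℝ) := by simp
  have hre : ((truncHamiltonian M nn h J).groundStateFunctional (truncHamiltonian M nn h J)).re ≤ 0 := by
    rw [hE, Complex.ofReal_re]
    exact hE0
  rw [hexp (truncHamiltonian M nn h J)] at hre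
  have hJ2 : 0 ≤ J / 2 := by positivity
  nlinarith [mul_le_mul_of_nonneg_left hbond hJ2]

end EnergyBounds

/-! ### On the torus: the edge weight is `O(L^d/M²)`, the Riemann sums, and the assembly -/

section Torus

variable (L : ℕ) [NeZero L] (M : ℕ)

/-- `|Λ| = L^d` as a real number. [folklore] -/
theorem card_torusSite_real : ((Fintype.card (TorusSite d L) : ℕ) : ℝ) = (L : ℝ) ^ d := by
  rw [Fintype.card_pi, prod_const, ZMod.card, card_univ, Fintype.card_fin, Nat.cast_pow]

/-- **The kinetic energy on the torus**: `Σ_x Re ω(N_x²) ≤ 2dJ L^d / h` (`L ≥ 3`, `h > 0`,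
`J ≥ 0`). [folklore] -/
theorem sum_re_groundStateFunctional_siteMomentumSq_torus_le (hL : 3 ≤ L) {h : ℝ} (hh : 0 < h)
    {J : ℝ} (hJ : 0 ≤ J) :
    ∑ x : TorusSite d L, ((truncHamiltonian M (torusGraph d L).Adj h J).groundStateFunctional
        (siteMomentumSq M x)).re ≤ 2 * d * J * (L : ℝ) ^ d / h := by
  have h1 := sum_re_groundStateFunctional_siteMomentumSq_le M (torusGraph d L).Adj
    (fun x => SimpleGraph.irrefl _) h hJ
  have hcard : ∑ x : TorusSite d L, (((univ.filter ((torusGraph d L).Adj x)).card : ℕ) : ℝ) =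
      2 * d * (L : ℝ) ^ d := by
    have h2 := sum_sum_filter_torusGraph_adj_left L hL (fun _ : TorusSite d L => (1 : ℝ))
    simp only [sum_const, nsmul_eq_mul, mul_one, card_univ] at h2
    rw [card_torusSite_real] at h2
    exact h2
  rw [hcard] at h1
  rw [le_div_iff₀ hh]
  nlinarith [h1]

/-- **The edge weight in the ground state is small**: `Σ_x Re ω(Π_x) ≤ 2dJ L^d/(h M²)` (Chebyshev
`M²Π_x ≤ N_x²` and the kinetic bound). [folklore] -/
theorem sum_re_groundStateFunctional_siteEdgeProj_le (hL : 3 ≤ L) (hM : 1 ≤ M) {h : ℝ} (hh : 0 < h)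
    {J : ℝ} (hJ : 0 ≤ J) :
    ∑ x : TorusSite d L, ((truncHamiltonian M (torusGraph d L).Adj h J).groundStateFunctional
        (siteEdgeProj M x)).re ≤ 2 * d * J * (L : ℝ) ^ d / (h * (M : ℝ) ^ 2) := by
  have hkin := sum_re_groundStateFunctional_siteMomentumSq_torus_le (d := d) L M hL hh hJ
  have hM0 : (0 : ℝ) < (M : ℝ) ^ 2 := by
    have h0 : (0 : ℝ) < M := by exact_mod_cast (show 0 < M by omega)
    positivity
  have hx : ∀ x : TorusSite d L, (M : ℝ) ^ 2 *
      ((truncHamiltonian M (torusGraph d L).Adj h J).groundStateFunctional (siteEdgeProj M x)).re ≤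
      ((truncHamiltonian M (torusGraph d L).Adj h J).groundStateFunctional (siteMomentumSq M x)).re := by
    intro x
    have h1 := re_groundStateFunctional_mono (truncHamiltonian M (torusGraph d L).Adj h J)
      (posSemidef_siteMomentumSq_sub_siteEdgeProj M x)
    rwa [LinearMap.map_smul, smul_eq_mul, show ((M : ℂ) ^ 2) = (((M : ℝ) ^ 2 : ℝ) : ℂ) by push_cast; ring,
      Complex.re_ofReal_mul] at h1
  have hsum := sum_le_sum (s := (univ : Finset (TorusSite d L))) fun x _ => hx x
  rw [← mul_sum] at hsum
  rw [le_div_iff₀ (by positivity)]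
  calc (∑ x : TorusSite d L, ((truncHamiltonian M (torusGraph d L).Adj h J).groundStateFunctional
        (siteEdgeProj M x)).re) * (h * (M : ℝ) ^ 2)
      = h * ((M : ℝ) ^ 2 * ∑ x : TorusSite d L,
          ((truncHamiltonian M (torusGraph d L).Adj h J).groundStateFunctional (siteEdgeProj M x)).re) := by
        ring
    _ ≤ h * ∑ x : TorusSite d L, ((truncHamiltonian M (torusGraph d L).Adj h J).groundStateFunctional
        (siteMomentumSq M x)).re := mul_le_mul_of_nonneg_left hsum hh.le
    _ ≤ h * (2 * d * J * (L : ℝ) ^ d / h) := mul_le_mul_of_nonneg_left hkin hh.le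
    _ = 2 * d * J * (L : ℝ) ^ d := by field_simp

/-- **`E_q^{-1/2}` against the KLS integrand**: for `d ≥ 1` and `q ≠ 0`,
`1/√E_q ≤ 2 F_d(q) + 2` (`F_d ≥ ½√(3d/2) E^{-1/2}` where `Σcos qᵢ ≥ d/2`, and `E > d/2` elsewhere).
[folklore] -/
theorem inv_sqrt_dispersion_le (hd : 1 ≤ d) {q : TorusSite d L} (hq : q ≠ 0) :
    1 / Real.sqrt (dispersion (latticeMomentum L q)) ≤ 2 * klsIntegrand d (latticeMomentum L q) + 2 := by
  set E := dispersion (latticeMomentum L q) with hE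
  set C := torusCosSum L q with hC
  have hEpos : 0 < E := dispersion_latticeMomentum_pos hq
  have hEC : E = d - C := by
    have h1 := sum_const_sub_mul_cos_latticeMomentum L q 1 1
    simp only [one_mul, mul_one] at h1
    rw [hE, ← h1]
    rfl
  have hF := klsIntegrand_latticeMomentum L q
  rw [← hE, ← hC] at hF
  have hF0 : 0 ≤ klsIntegrand d (latticeMomentum L q) := klsIntegrand_nonneg _ _
  have hd' : (1 : ℝ) ≤ d := by exact_mod_cast hd
  by_cases hcase : (d : ℝ) / 2 ≤ C
  · -- `2F ≥ √((d+C)/E) ≥ 1/√E`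
    have hCd : 1 ≤ 2 * (C / d) := by
      rw [mul_div_assoc', le_div_iff₀ (by positivity)]
      linarith
    have hmax : max (C / d) 0 = C / d := max_eq_left (div_nonneg (by linarith) (by positivity))
    have h1 : 1 / Real.sqrt E ≤ Real.sqrt ((d + C) / E) := by
      rw [one_div, ← Real.sqrt_inv]
      refine Real.sqrt_le_sqrt ?_
      rw [inv_eq_one_div, div_le_div_iff_of_pos_right hEpos]
      linarith
    have h2 : Real.sqrt ((d + C) / E) ≤ 2 * klsIntegrand d (latticeMomentum L q) := by
      rw [hF, hmax]
      have hs : 0 ≤ Real.sqrt ((d + C) / E) := Real.sqrt_nonneg _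
      nlinarith
    linarith
  · -- `E > d/2 ≥ 1/2`, so `1/√E ≤ 2`
    push Not at hcase
    have hE2 : 1 / 4 ≤ E := by rw [hEC]; linarith
    have h1 : 1 / Real.sqrt E ≤ 2 := by
      rw [div_le_iff₀ (Real.sqrt_pos.2 hEpos)]
      have : 1 / 2 ≤ Real.sqrt E := by
        rw [show (1 / 2 : ℝ) = Real.sqrt (1 / 4) by
          rw [show (1 / 4 : ℝ) = (1 / 2) ^ 2 by norm_num, Real.sqrt_sq (by norm_num)]]
        exact Real.sqrt_le_sqrt hE2
      linarith
    linarith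

/-- **The punctured Riemann sum of `E^{-1/2}`** is at most `(2 R_L + 2) L^d`, `R_L` the KLS
Riemann sum of the tree (`klsRiemannSum`). [folklore] -/
theorem sum_inv_sqrt_dispersion_le (hd : 1 ≤ d) :
    ∑ q ∈ (univ : Finset (TorusSite d L)).erase 0, 1 / Real.sqrt (dispersion (latticeMomentum L q)) ≤
      (2 * klsRiemannSum d L + 2) * (L : ℝ) ^ d := by
  have hLd : 0 < (L : ℝ) ^ d := by
    have : (0 : ℝ) < L := by exact_mod_cast Nat.pos_of_ne_zero (NeZero.ne L)
    positivity
  have hR : ∑ q ∈ (univ : Finset (TorusSite d L)).erase 0, klsIntegrand d (latticeMomentum L q) =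
      klsRiemannSum d L * (L : ℝ) ^ d := by
    rw [klsRiemannSum_of_neZero, div_mul_cancel₀ _ hLd.ne']
  have hcard : (((univ : Finset (TorusSite d L)).erase 0).card : ℝ) ≤ (L : ℝ) ^ d := by
    have h1 : ((univ : Finset (TorusSite d L)).erase 0).card ≤ (univ : Finset (TorusSite d L)).card :=
      card_le_card (erase_subset _ _)
    have h2 : ((univ : Finset (TorusSite d L)).card : ℝ) = (L : ℝ) ^ d := by
      rw [card_univ, card_torusSite_real]
    rw [← h2]
    exact_mod_cast h1
  calc ∑ q ∈ (univ : Finset (TorusSite d L)).erase 0, 1 / Real.sqrt (dispersion (latticeMomentum L q))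
      ≤ ∑ q ∈ (univ : Finset (TorusSite d L)).erase 0, (2 * klsIntegrand d (latticeMomentum L q) + 2) :=
        sum_le_sum fun q hq => inv_sqrt_dispersion_le L hd (mem_erase.1 hq).1
    _ = 2 * (klsRiemannSum d L * (L : ℝ) ^ d) + 2 * (((univ : Finset (TorusSite d L)).erase 0).card : ℝ) := by
        rw [sum_add_distrib, ← mul_sum, hR, sum_const, nsmul_eq_mul, mul_comm _ (2 : ℝ)]
    _ ≤ (2 * klsRiemannSum d L + 2) * (L : ℝ) ^ d := by nlinarith

/-- **Long-range order of the Galerkin ground states, quantitatively** (the rotator version of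
Kennedy–Lieb–Shastry 1988, eqs. (5)–(8), in finite volume and at finite truncation; the
matrix-side content of [WojtkiewiczPuszStachura2016] Thm. 3.3): on the even torus of side `L ≥ 4`,
for `d ≥ 1`, `M ≥ 1`, `h, J > 0`, with `R_L` the KLS Riemann sum and
`Γ_M = h + J (2d/M + (dM/2 + d/2) · 2dJ/(hM²))`,
`1 - dJ/(hM²) - 2 √(Γ_M/(8J)) (2R_L + 2) ≤ L^{-2d} Σ_{x,y} Re ω(cos_x cos_y + sin_x sin_y)`.
[cite: KLS1988PRL, eqs. (5)–(8)] [cite: WojtkiewiczPuszStachura2016, Thm. 3.3, §3.3] -/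
theorem truncated_groundState_lro (hd : 1 ≤ d) (hLe : Even L) (h4 : 4 ≤ L) (hM : 1 ≤ M)
    {h J : ℝ} (hh : 0 < h) (hJ : 0 < J) :
    1 - d * J / (h * (M : ℝ) ^ 2) -
        2 * Real.sqrt ((h + J * (2 * (M : ℝ)⁻¹ * d +
          (d / (2 * (M : ℝ)⁻¹) + d / 2) * (2 * d * J * 1 / (h * (M : ℝ) ^ 2)))) / (8 * J)) *
          (2 * klsRiemannSum d L + 2) ≤
      (∑ x : TorusSite d L, ∑ y : TorusSite d L,
        ((truncHamiltonian M (torusGraph d L).Adj h J).groundStateFunctional (truncBond M x y)).re) /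
        ((L : ℝ) ^ d) ^ 2 := by
  have hL3 : 3 ≤ L := by omega
  -- notation
  set H : Op (TorusSite d L) (2 * M + 1) := truncHamiltonian M (torusGraph d L).Adj h J with hH_def
  have hH : H.IsHermitian := truncHamiltonian_isHermitian M _ h J
  set N : ℝ := (L : ℝ) ^ d with hN_def
  have hN : 0 < N := by
    have : (0 : ℝ) < L := by exact_mod_cast Nat.pos_of_ne_zero (NeZero.ne L)
    positivity
  set S : TorusSite d L → ℝ := fun q => (H.groundStateFunctional (rotorCosMode L M q * rotorCosMode L M q)).re +
    (H.groundStateFunctional (rotorSinMode L M q * rotorSinMode L M q)).re with hS_def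
  set π : TorusSite d L → ℝ := fun x => (H.groundStateFunctional (siteEdgeProj M x)).re with hπ_def
  set R : ℝ := klsRiemannSum d L with hR_def
  set ε : ℝ := (M : ℝ)⁻¹ with hε_def
  have hM0 : (0 : ℝ) < M := by exact_mod_cast (show 0 < M by omega)
  have hε : 0 < ε := inv_pos.2 hM0
  set Γ : ℝ := h + J * (2 * ε * d + (d / (2 * ε) + d / 2) * (2 * d * J * 1 / (h * (M : ℝ) ^ 2))) with hΓ_def
  -- Gaussian domination ⇒ infrared bound, double commutator bound, edge weight
  have hGD : ∀ b : TorusSite d L → ℝ, H.groundEnergy ≤ (rotorFieldHamiltonian L M h J b).groundEnergy :=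
    fun b => truncHamiltonian_groundEnergy_le_field L M hLe h4 h hJ.le b
  have hPi : ∑ x : TorusSite d L, π x ≤ 2 * d * J * 1 / (h * (M : ℝ) ^ 2) * N := by
    have h1 := sum_re_groundStateFunctional_siteEdgeProj_le (d := d) L M hL3 hM hh hJ.le
    rw [← hH_def, ← hN_def] at h1
    calc ∑ x : TorusSite d L, π x ≤ 2 * d * J * N / (h * (M : ℝ) ^ 2) := h1
      _ = 2 * d * J * 1 / (h * (M : ℝ) ^ 2) * N := by ring
  have hΓ0 : 0 ≤ Γ := by
    have : 0 ≤ 2 * d * J * 1 / (h * (M : ℝ) ^ 2) := by positivity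
    positivity
  have hDC : ∀ q : TorusSite d L, (H.groundStateFunctional ⁅rotorCosMode L M q, ⁅H, rotorCosMode L M q⁆⁆).re +
      (H.groundStateFunctional ⁅rotorSinMode L M q, ⁅H, rotorSinMode L M q⁆⁆).re ≤ N * Γ := by
    intro q
    have h1 := re_lie_lie_modes_le L M hL3 hM hh.le hJ.le hε q
    rw [← hH_def, ← hN_def] at h1
    have hcoef : 0 ≤ J * (d / (2 * ε) + d / 2) := by positivity
    have h2 : J * (2 * ε * d * N + (d / (2 * ε) + d / 2) * ∑ x : TorusSite d L, π x) ≤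
        J * (2 * ε * d * N + (d / (2 * ε) + d / 2) * (2 * d * J * 1 / (h * (M : ℝ) ^ 2) * N)) := by
      have := mul_le_mul_of_nonneg_left hPi hcoef
      nlinarith
    calc _ ≤ h * N + J * (2 * ε * d * N + (d / (2 * ε) + d / 2) * ∑ x : TorusSite d L, π x) := h1
      _ ≤ h * N + J * (2 * ε * d * N + (d / (2 * ε) + d / 2) * (2 * d * J * 1 / (h * (M : ℝ) ^ 2) * N)) := by
          linarith
      _ = N * Γ := by rw [hΓ_def]; ring
  -- `S(q) ≤ N √(Γ/(8J)) / √E_q` for `q ≠ 0`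
  have hSq : ∀ q : TorusSite d L, q ≠ 0 →
      S q ≤ N * Real.sqrt (Γ / (8 * J)) * (1 / Real.sqrt (dispersion (latticeMomentum L q))) := by
    intro q hq
    obtain ⟨hS0, hIR⟩ := rotor_infraredBound_of_groundEnergy_le L M h hJ hGD q hq
    rw [← hH_def] at hS0 hIR
    change 0 ≤ S q at hS0
    change J * S q ^ 2 * (8 * dispersion (latticeMomentum L q)) ≤ N * _ at hIR
    have hE : 0 < dispersion (latticeMomentum L q) := dispersion_latticeMomentum_pos hq
    have h1 : S q ^ 2 ≤ N ^ 2 * (Γ / (8 * J)) / dispersion (latticeMomentum L q) := by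
      rw [le_div_iff₀ hE]
      have h2 := (hIR.trans (mul_le_mul_of_nonneg_left (hDC q) hN.le))
      have h3 : S q ^ 2 * dispersion (latticeMomentum L q) * (8 * J) ≤ N * (N * Γ) := by nlinarith
      rw [show N ^ 2 * (Γ / (8 * J)) = N * (N * Γ) / (8 * J) by ring, le_div_iff₀ (by positivity)]
      exact h3
    have h2 : S q ≤ Real.sqrt (N ^ 2 * (Γ / (8 * J)) / dispersion (latticeMomentum L q)) :=
      Real.le_sqrt_of_sq_le h1
    rw [Real.sqrt_div' _ hE.le, Real.sqrt_mul (by positivity), Real.sqrt_sq hN.le] at h2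
    rw [mul_one_div]
    exact h2
  -- the sum rule
  have hsum : ∑ q : TorusSite d L, S q = N * (N / 2 - 1 / 4 * ∑ x : TorusSite d L, π x) := by
    have h1 := sum_re_modes_sq L M H
    rw [← hN_def] at h1
    rw [hS_def, h1]
    congr 1
    rw [sum_congr rfl fun x _ => re_groundStateFunctional_siteCos_sq M (torusGraph d L).Adj h J x,
      sum_sub_distrib, sum_const, card_univ, nsmul_eq_mul, card_torusSite_real, ← mul_sum]
    ring
  -- `S 0 = Σ_q S q - Σ_{q ≠ 0} S q`
  have hsplit : S 0 = ∑ q : TorusSite d L, S q - ∑ q ∈ (univ : Finset (TorusSite d L)).erase 0, S q := by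
    rw [← Finset.add_sum_erase _ _ (mem_univ (0 : TorusSite d L))]
    ring
  have hrest : ∑ q ∈ (univ : Finset (TorusSite d L)).erase 0, S q ≤
      N * Real.sqrt (Γ / (8 * J)) * ((2 * R + 2) * N) := by
    calc ∑ q ∈ (univ : Finset (TorusSite d L)).erase 0, S q
        ≤ ∑ q ∈ (univ : Finset (TorusSite d L)).erase 0,
            N * Real.sqrt (Γ / (8 * J)) * (1 / Real.sqrt (dispersion (latticeMomentum L q))) :=
          sum_le_sum fun q hq => hSq q (mem_erase.1 hq).1
      _ = N * Real.sqrt (Γ / (8 * J)) *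
            ∑ q ∈ (univ : Finset (TorusSite d L)).erase 0, 1 / Real.sqrt (dispersion (latticeMomentum L q)) := by
          rw [mul_sum]
      _ ≤ N * Real.sqrt (Γ / (8 * J)) * ((2 * R + 2) * N) :=
          mul_le_mul_of_nonneg_left (sum_inv_sqrt_dispersion_le L hd) (by positivity)
  -- the order parameter is `2 S(0)`
  have hLRO : ∑ x : TorusSite d L, ∑ y : TorusSite d L, (H.groundStateFunctional (truncBond M x y)).re = 2 * S 0 := by
    rw [hH_def, sum_sum_re_groundStateFunctional_truncBond, ← hH_def]
    simp only [hS_def]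
    rw [re_modes_sq_zero]
  -- assemble
  rw [hLRO, hsplit, hsum, le_div_iff₀ (by positivity)]
  have hkey : N * (N / 2 - 1 / 4 * ∑ x : TorusSite d L, π x) -
      ∑ q ∈ (univ : Finset (TorusSite d L)).erase 0, S q ≥
      N * (N / 2 - 1 / 4 * (2 * d * J * 1 / (h * (M : ℝ) ^ 2) * N)) - N * Real.sqrt (Γ / (8 * J)) * ((2 * R + 2) * N) := by
    nlinarith [hPi, hrest, hN]
  have hR0 : 0 ≤ R := klsRiemannSum_nonneg _ _
  have hsq0 : 0 ≤ Real.sqrt (Γ / (8 * J)) := Real.sqrt_nonneg _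
  calc (1 - d * J / (h * (M : ℝ) ^ 2) - 2 * Real.sqrt (Γ / (8 * J)) * (2 * R + 2)) * (N ^ 2)
      = 2 * (N * (N / 2 - 1 / 4 * (2 * d * J * 1 / (h * (M : ℝ) ^ 2) * N)) -
          N * Real.sqrt (Γ / (8 * J)) * ((2 * R + 2) * N)) := by ring
    _ ≤ 2 * (N * (N / 2 - 1 / 4 * ∑ x : TorusSite d L, π x) -
          ∑ q ∈ (univ : Finset (TorusSite d L)).erase 0, S q) := by linarith
    _ = _ := by ring

end Torus

end QuantumRotor

end Literature.MathematicalPhysics.QuantumLattice
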